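import Literature.Computability.Complexity.StockmeyerEstimator
import Literature.Computability.Complexity.ValiantVaziraniLemma
import Literature.Computability.Complexity.CountingProofs
import Literature.Computability.Complexity.BPPErrorReduction
import HarnessLib

/-!
# Isolation advice: Valiant–Vazirani in the coin model, Adleman's trick, and the counting
behind Bürgisser's Theorem 3.1

Trunk T-CPLX-CORE. The mathematics (no machines) of the proof of Bürgisser, *Cook's versus
Valiant's hypothesis*, TCS 235 (2000), Thm. 3.1, p. 77 ("For a prime `p` we have
`NP/poly ⊆ Mod_pNP/poly`"), proof pp. 78–79: the Valiant–Vazirani reduction [27] ("`#ψ = 0 ⇒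
#ψ_w = 0`, `#ψ > 0 ⇒ Prob[#ψ_w ≠ 1] ≤ 1 − (4n)⁻¹`"), its amplification over `q` independent random
strings combined by Lemma 3.2(4) ("`#φ = 1 + ∏ⱼ (p − 1 + #ψⱼ)`"), and "Adleman's trick" [1] ("for
each `a` there exist `w₁, …, w_q` such that for all cnfs `ψ` of size `a` we have
`#ψ > 0 ⇒ #φ ≡ 1 mod p`. The bitstrings `w₁, …, w_q` then serve as an advice"). Everything is
proved from the tree's affine hashing (`AffineHashing.lean`, `ValiantVaziraniLemma.lean`:
`valiant_vazirani`, `exists_goodLevel`) in the coin layout of `StockmeyerEstimator.lean` (`coinHash`,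
`HashesToZero`, `levelCount`, `card_filter_coinHash`), which is the layout a polynomial-time
relation evaluates (`HashBricks.andParityFn`). No definitions are introduced.

* **Counting on coin strings** (`cnt`, `CoinCounting.lean`; additivity `cnt_union_of_disjoint` is
  in `BPPErrorReduction.lean`, the product rule `cnt_take_drop` — Lemma 3.2(1), "`#(φ ∧ ψ) =
  #φ · #ψ`" — in `ProbabilisticClassesProofs.lean`): `cnt_eq_one_of_length_eq` (one fixed string),
  `cnt_blocks` (`F` consecutive blocks of length `B`: `∏ᵢ cnt B (OKᵢ)`), `cnt_count_true_eq_one`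
  (`n` strings of weight one), `cnt_flag` (`1 + ·` by a flag bit) and `cnt_block` (`c + d` by a
  block `y e`, `e ∈ {0^d} ∪ {weight one}`) — the witness formats realising Lemma 3.2(2)–(4);
* **Lemma 3.2(4) mod `p`**: `succ_prod_mod_eq_zero` (all counts `0`, an odd number of factors:
  `1 + (p−1)^F ≡ 0`) and `succ_prod_mod_eq_one` (one count `= 1`: `1 + p·(…) ≡ 1`);
* **Valiant–Vazirani in the coin model**: `card_le_eight_mul_card_isolating` — if `x` has a
  witness of length `m`, at least a `1/8` fraction of the coin strings `u ∈ {0,1}^ℓ`,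
  `ℓ ≥ (m+2)(m+1)`, isolate at some level `k ≤ m + 2` (`levelCount R m x u k = 1`);
* **Adleman's trick**: `exists_good_tuple` (abstract union bound: events of density `≥ 1/8` for
  `≤ 2ⁿ` points are hit simultaneously by some `t`-tuple as soon as `2ⁿ 7ᵗ < 8ᵗ`),
  `two_pow_mul_seven_pow_lt` (`t = 6n + 1` suffices) and **`exists_isolating_seeds`**: `t` coin
  strings `u₀, …, u_{t−1}` such that every `x ∈ {0,1}ⁿ` with a witness is isolated by some `uⱼ` at
  some level `k ≤ m + 2`.

## References

* P. Bürgisser, *Cook's versus Valiant's hypothesis*, Theoret. Comput. Sci. 235 (2000) 71–88,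
  Thm. 3.1 (p. 77), Lemma 3.2 and the proof (pp. 78–79).
* L. G. Valiant, V. V. Vazirani, *NP is as easy as detecting unique solutions*, Theoret. Comput.
  Sci. 47 (1986) 85–93.
* L. Adleman, *Two theorems on random polynomial time*, FOCS 1978, 75–83.
* S. Arora, B. Barak, *Computational Complexity: A Modern Approach*, CUP 2009, Lemma 17.19,
  Thm. 17.18 (proof), §7.4 area (Adleman's `BPP ⊆ P/poly`, Thm. 7.14).
-/

namespace Literature.Computability.Complexity

open Finset _root_.Computability

open scoped Classical

/-! ### Counting on coin strings -/

/-- One fixed string of length `n`: `cnt n {v} = 1`. [folklore] -/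
theorem cnt_eq_one_of_length_eq {n : ℕ} {v : List Bool} (hv : v.length = n) :
    cnt n {w | w = v} = 1 := by
  unfold cnt
  rw [card_eq_one]
  refine ⟨⟨v, hv⟩, ?_⟩
  ext r
  simp only [mem_filter, mem_univ, true_and, Set.mem_setOf_eq, mem_singleton]
  constructor
  · intro h; exact List.Vector.toList_injective (by simpa using h)
  · rintro rfl; rfl

/-- The all-zeros string is the only string of its length equal to `0…0`. [folklore] -/
theorem cnt_eq_replicate_false (n : ℕ) : cnt n {w | w = List.replicate n false} = 1 :=
  cnt_eq_one_of_length_eq (by simp)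

/-- The all-ones string is the only string of its length equal to `1…1`. [folklore] -/
theorem cnt_eq_replicate_true (n : ℕ) : cnt n {w | w = List.replicate n true} = 1 :=
  cnt_eq_one_of_length_eq (by simp)

/-- **Block events**: on `F` consecutive blocks of length `B`, the strings all of whose blocks
`i < F` lie in `OK i` number `∏ᵢ cnt B (OK i)` (iterated Lemma 3.2(1)). [cite: Burgisser2000TCS, Lemma 3.2(1) p. 78] -/
theorem cnt_blocks (B : ℕ) (OK : ℕ → Set (List Bool)) : ∀ F : ℕ,
    cnt (F * B) {y | ∀ i < F, (y.drop (i * B)).take B ∈ OK i} = ∏ i ∈ range F, cnt B (OK i)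
  | 0 => by
    rw [Nat.zero_mul, cnt_zero, prod_range_zero]
    simp
  | F + 1 => by
    have ih := cnt_blocks B (fun i => OK (i + 1)) F
    rw [show (F + 1) * B = B + F * B by ring, prod_range_succ',
      mul_comm (∏ i ∈ range F, cnt B (OK (i + 1))) (cnt B (OK 0)), ← ih, ← cnt_take_drop]
    refine cnt_congr fun y _ => ?_
    simp only [Set.mem_setOf_eq]
    constructor
    · intro h
      refine ⟨by simpa using h 0 (Nat.succ_pos F), fun i hi => ?_⟩
      have := h (i + 1) (by omega)
      rwa [show (i + 1) * B = B + i * B by ring, ← List.drop_drop] at this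
    · rintro ⟨h0, h⟩ i hi
      rcases i with _ | i
      · simpa using h0
      · have := h i (by omega)
        rwa [show (i + 1) * B = B + i * B by ring, ← List.drop_drop]

/-- **Strings of weight one**: exactly `n` strings of length `n` have a single `1` (the `p − 1`
dummy witnesses of Lemma 3.2(3)/(4) are coded this way). [cite: Burgisser2000TCS, Lemma 3.2(3) p. 78] -/
theorem cnt_count_true_eq_one : ∀ n : ℕ, cnt n {e | e.count true = 1} = n
  | 0 => by rw [cnt_zero]; simp
  | n + 1 => by
    rw [cnt_succ]
    have h0 : cnt n {y : List Bool | false :: y ∈ {e : List Bool | e.count true = 1}} = n :=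
      (cnt_congr fun y _ => by simp).trans (cnt_count_true_eq_one n)
    have h1 : cnt n {y : List Bool | true :: y ∈ {e : List Bool | e.count true = 1}} = 1 :=
      (cnt_congr fun y _ => by simp [List.count_eq_zero]).trans (PPSharpP.cnt_noTrue n)
    rw [h0, h1]

/-- **The flag bit** (Lemma 3.2(2) with one extra satisfying assignment: "`#ρ = #φ + #ψ`"): on
`w = b w'`, accepting `1 0^N` and `0 w'` with `w' ∈ P` counts `1 + cnt N P`. [cite: Burgisser2000TCS, Lemma 3.2(2) p. 78] -/
theorem cnt_flag (N : ℕ) (P : Set (List Bool)) :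
    cnt (1 + N) {w | (w.headD false = true ∧ w.drop 1 = List.replicate N false) ∨
      (w.headD false = false ∧ w.drop 1 ∈ P)} = 1 + cnt N P := by
  rw [Nat.add_comm 1 N, cnt_succ, Nat.add_comm 1]
  congr 1
  · exact cnt_congr fun y _ => by simp
  · exact (cnt_congr fun y _ => by simp).trans (cnt_eq_replicate_false N)

/-- **One block** (Lemma 3.2(3)–(4): "`p − 1 + #ψⱼ`"): on `b = y e`, `|y| = m`, `|e| = d`, accepting
`e = 0^d ∧ y ∈ G` or `wt(e) = 1 ∧ y = 0^m` counts `cnt m G + d`. [cite: Burgisser2000TCS, Lemma 3.2(4) p. 78] -/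
theorem cnt_block (m d : ℕ) (G : Set (List Bool)) :
    cnt (m + d) {b | (b.drop m = List.replicate d false ∧ b.take m ∈ G) ∨
      ((b.drop m).count true = 1 ∧ b.take m = List.replicate m false)} = cnt m G + d := by
  have hsplit : {b : List Bool | (b.drop m = List.replicate d false ∧ b.take m ∈ G) ∨
      ((b.drop m).count true = 1 ∧ b.take m = List.replicate m false)} =
      {b | b.take m ∈ G ∧ b.drop m ∈ {e : List Bool | e = List.replicate d false}} ∪
        {b | b.take m ∈ {y : List Bool | y = List.replicate m false} ∧
          b.drop m ∈ {e : List Bool | e.count true = 1}} := by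
    ext b
    simp only [Set.mem_setOf_eq, Set.mem_union]
    tauto
  rw [hsplit, cnt_union_of_disjoint, cnt_take_drop, cnt_take_drop, cnt_eq_replicate_false,
    cnt_eq_replicate_false, cnt_count_true_eq_one, mul_one, one_mul]
  refine Set.disjoint_left.2 fun b ⟨_, h1⟩ ⟨_, h2⟩ => ?_
  simp only [Set.mem_setOf_eq] at h1 h2
  rw [h1, List.count_replicate] at h2
  simp at h2

/-! ### Lemma 3.2(4) modulo `p` -/

/-- **All counts zero, an odd number of factors**: `1 + ∏ᵢ (p − 1 + cᵢ) ≡ 1 + (−1)^F ≡ 0 (mod p)`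
(Bürgisser 2000 TCS, p. 78: "`#ψ = 0 ⇒ #φ ≡ 0 mod p`", `q` odd). [cite: Burgisser2000TCS, proof of Thm. 3.1 p. 78] -/
theorem succ_prod_mod_eq_zero {p F : ℕ} (hp : 2 ≤ p) (hF : Odd F) {c : ℕ → ℕ}
    (h0 : ∀ i < F, c i = 0) : (1 + ∏ i ∈ range F, (p - 1 + c i)) % p = 0 := by
  have hprod : ∏ i ∈ range F, (p - 1 + c i) = (p - 1) ^ F := by
    rw [Finset.prod_congr rfl fun i hi => by rw [h0 i (mem_range.1 hi), add_zero], prod_const,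
      card_range]
  rw [hprod]
  haveI : NeZero p := ⟨by omega⟩
  apply Nat.mod_eq_zero_of_dvd
  apply (ZMod.natCast_eq_zero_iff _ p).1
  rw [Nat.cast_add, Nat.cast_one, Nat.cast_pow, Nat.cast_sub (by omega : 1 ≤ p), Nat.cast_one,
    ZMod.natCast_self, zero_sub, hF.neg_one_pow]
  ring

/-- **One count equal to one**: the factor `p − 1 + 1 = p` kills the product, so
`1 + ∏ᵢ (p − 1 + cᵢ) ≡ 1 (mod p)` (Bürgisser 2000 TCS, p. 78: "`#ψ_w = 1`" for some `w`). [cite: Burgisser2000TCS, proof of Thm. 3.1 p. 78] -/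
theorem succ_prod_mod_eq_one {p F : ℕ} (hp : 2 ≤ p) {c : ℕ → ℕ} {i₀ : ℕ} (hi₀ : i₀ < F)
    (h1 : c i₀ = 1) : (1 + ∏ i ∈ range F, (p - 1 + c i)) % p = 1 := by
  have hi : p - 1 + c i₀ = p := by rw [h1]; omega
  have hdvd : p ∣ ∏ i ∈ range F, (p - 1 + c i) := by
    have h := Finset.dvd_prod_of_mem (fun i => p - 1 + c i) (mem_range.2 hi₀)
    rwa [hi] at h
  obtain ⟨K, hK⟩ := hdvd
  rw [hK, Nat.add_mul_mod_self_left, Nat.mod_eq_of_lt (by omega)]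

/-! ### Valiant–Vazirani in the coin model -/

namespace Stockmeyer

open AffineHash

/-- **Isolation by a random coin string.** If `x` has an `R`-witness of length `m`
(`countWitnesses R m x > 0`) and `ℓ ≥ (m + 2)(m + 1)`, then for at least a `1/8` fraction of the
coin strings `u ∈ {0,1}^ℓ` some level `k ≤ m + 2` isolates a unique witness hashed to zero,
`levelCount R m x u k = 1` (Valiant–Vazirani at the good level `k = ⌊log₂ #⌋ + 2`,
`exists_goodLevel` and `valiant_vazirani`, transported to coin strings along the equal-fibre map
`u ↦ coinHash u m k`, `card_filter_coinHash`; Bürgisser 2000 TCS, p. 78: "`#ψ > 0 ⇒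
Prob[#ψ_w ≠ 1] ≤ 1 − (4n)⁻¹`", here with the tree's constant `1/8` at a hard-wired level). [cite: Burgisser2000TCS, proof of Thm. 3.1 p. 78] [cite: ValiantVazirani1986] [cite: AroraBarak2009, Lemma 17.19] -/
theorem card_le_eight_mul_card_isolating (R : Language Bool) {m ℓ : ℕ} (x : List Bool)
    (hx : 0 < countWitnesses R m x) (hℓ : (m + 2) * (m + 1) ≤ ℓ) :
    Fintype.card (List.Vector Bool ℓ) ≤
      8 * (univ.filter fun u : List.Vector Bool ℓ =>
        ∃ k ≤ m + 2, levelCount R m x u.toList k = 1).card := by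
  set S := witnessSet R m x with hS
  have hcard : S.card = countWitnesses R m x := card_witnessSet R m x
  obtain ⟨k, hk, hlo, hhi⟩ := exists_goodLevel (n := m) (s := S.card) (by omega)
    (by rw [hcard]; exact countWitnesses_le_two_pow R m x)
  have hvv := valiant_vazirani S hlo hhi
  have hℓk : k * (m + 1) ≤ ℓ := (Nat.mul_le_mul_right _ hk).trans hℓ
  have hfib := card_filter_coinHash hℓk fun h : Hash m k => zeroCount S h = 1
  -- `#{u | level k isolates} · 8 ≥ 2^ℓ`
  have hsub : (univ.filter fun u : List.Vector Bool ℓ => zeroCount S (coinHash u.toList m k) = 1).card ≤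
      (univ.filter fun u : List.Vector Bool ℓ => ∃ k ≤ m + 2, levelCount R m x u.toList k = 1).card := by
    refine card_le_card fun u hu => ?_
    simp only [mem_filter, mem_univ, true_and] at hu ⊢
    exact ⟨k, hk, by rw [levelCount_eq_zeroCount, ← hS]; exact hu⟩
  have hH : 0 < Fintype.card (Hash m k) := Fintype.card_pos
  have hvv' : Fintype.card (Hash m k) ≤ 8 * (univ.filter fun h : Hash m k => zeroCount S h = 1).card := by
    refine hvv.trans (le_of_eq ?_)
    congr 2
  have hfib' : (univ.filter fun u : List.Vector Bool ℓ => zeroCount S (coinHash u.toList m k) = 1).card *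
      Fintype.card (Hash m k) = (univ.filter fun h : Hash m k => zeroCount S h = 1).card * 2 ^ ℓ := by
    convert hfib
  refine le_trans ?_ (Nat.mul_le_mul_left 8 hsub)
  refine Nat.le_of_mul_le_mul_right ?_ hH
  rw [card_vector, Fintype.card_bool]
  calc 2 ^ ℓ * Fintype.card (Hash m k)
      ≤ 2 ^ ℓ * (8 * (univ.filter fun h : Hash m k => zeroCount S h = 1).card) :=
        Nat.mul_le_mul_left _ hvv'
    _ = 8 * ((univ.filter fun h : Hash m k => zeroCount S h = 1).card * 2 ^ ℓ) := by ring
    _ = 8 * (univ.filter fun u : List.Vector Bool ℓ => zeroCount S (coinHash u.toList m k) = 1).card *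
          Fintype.card (Hash m k) := by rw [← hfib']; ring

end Stockmeyer

/-! ### Adleman's trick -/

/-- **Adleman's union bound** (abstract form of "Adleman's trick", Bürgisser 2000 TCS, p. 78:
"`N_a (1 − (4n)⁻¹)^{q} < 1` … for each `a` there exist `w₁, …, w_q` such that for all cnfs of size
`a` …"): if each of at most `2ⁿ` points `x` has a set `Good x` of density `≥ 1/8` in a finite
nonempty type `U`, and `2ⁿ 7ᵗ < 8ᵗ`, then some `t`-tuple meets every `Good x` (the tuples missing
`Good x` number `(#U − #Good x)ᵗ ≤ (7/8)ᵗ #Uᵗ`, and `2ⁿ (7/8)ᵗ < 1`). [cite: Burgisser2000TCS, proof of Thm. 3.1 p. 78] [cite: Adleman1978] -/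
theorem exists_good_tuple {α U : Type*} [Fintype U] [Nonempty U] {n t : ℕ} (X : Finset α)
    (Good : α → Finset U) (hX : X.card ≤ 2 ^ n)
    (hd : ∀ x ∈ X, Fintype.card U ≤ 8 * (Good x).card) (ht : 2 ^ n * 7 ^ t < 8 ^ t) :
    ∃ s : Fin t → U, ∀ x ∈ X, ∃ j, s j ∈ Good x := by
  by_contra hcon
  push Not at hcon
  set N := Fintype.card U with hN
  have hNpos : 0 < N := Fintype.card_pos
  -- every tuple misses some `Good x`: the tuples are covered by the bad boxes
  have hcover : (univ : Finset (Fin t → U)) ⊆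
      X.biUnion fun x => Fintype.piFinset fun _ : Fin t => (Good x)ᶜ := by
    intro s _
    obtain ⟨x, hx, hs⟩ := hcon s
    exact mem_biUnion.2 ⟨x, hx, Fintype.mem_piFinset.2 fun j => mem_compl.2 (hs j)⟩
  have hcount : N ^ t ≤ ∑ x ∈ X, (N - (Good x).card) ^ t := by
    have := card_le_card hcover
    rw [card_univ, Fintype.card_fun, Fintype.card_fin] at this
    refine this.trans ((card_biUnion_le).trans (le_of_eq (sum_congr rfl fun x _ => ?_)))
    rw [Fintype.card_piFinset, prod_const, card_univ, Fintype.card_fin, card_compl]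
  -- `8 (N − #Good x) ≤ 7 N`
  have hbad : ∀ x ∈ X, (8 * (N - (Good x).card)) ^ t ≤ (7 * N) ^ t := fun x hx =>
    Nat.pow_le_pow_left (by have := hd x hx; omega) t
  have h8 : 8 ^ t * N ^ t ≤ 2 ^ n * 7 ^ t * N ^ t := by
    calc 8 ^ t * N ^ t ≤ 8 ^ t * ∑ x ∈ X, (N - (Good x).card) ^ t := Nat.mul_le_mul_left _ hcount
      _ = ∑ x ∈ X, (8 * (N - (Good x).card)) ^ t := by rw [mul_sum]; simp [mul_pow]
      _ ≤ ∑ x ∈ X, (7 * N) ^ t := sum_le_sum hbad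
      _ = X.card * (7 ^ t * N ^ t) := by rw [sum_const, smul_eq_mul, mul_pow]
      _ ≤ 2 ^ n * (7 ^ t * N ^ t) := Nat.mul_le_mul_right _ hX
      _ = 2 ^ n * 7 ^ t * N ^ t := by ring
  have hNt : 0 < N ^ t := Nat.pow_pos hNpos
  have := Nat.le_of_mul_le_mul_right h8 hNt
  omega

/-- **`t = 6n + 1` random strings suffice**: `2ⁿ 7^{6n+1} < 8^{6n+1}` (as `2 · 7⁶ = 235298 <
262144 = 8⁶`; Bürgisser: "`q = a^{O(1)}` big enough"). [cite: Burgisser2000TCS, proof of Thm. 3.1 p. 78] -/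
theorem two_pow_mul_seven_pow_lt (n : ℕ) : 2 ^ n * 7 ^ (6 * n + 1) < 8 ^ (6 * n + 1) := by
  have h : (2 * 7 ^ 6) ^ n ≤ (8 ^ 6) ^ n := Nat.pow_le_pow_left (by norm_num) n
  calc 2 ^ n * 7 ^ (6 * n + 1) = 7 * (2 * 7 ^ 6) ^ n := by
        rw [mul_pow, ← pow_mul, pow_add, pow_one]; ring
    _ ≤ 7 * (8 ^ 6) ^ n := Nat.mul_le_mul_left 7 h
    _ < 8 * (8 ^ 6) ^ n := Nat.mul_lt_mul_of_pos_right (by norm_num) (Nat.pow_pos (by norm_num))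
    _ = 8 ^ (6 * n + 1) := by rw [← pow_mul, pow_add, pow_one]; ring

/-- **Isolating seeds** (Valiant–Vazirani + Adleman, Bürgisser 2000 TCS, proof of Thm. 3.1,
pp. 78–79): for a relation `R`, a witness length `m`, an input length `n`, a number `t` of seeds
with `2ⁿ 7ᵗ < 8ᵗ` and a coin length `ℓ ≥ (m + 2)(m + 1)`, there are coin strings
`u₀, …, u_{t−1} ∈ {0,1}^ℓ` such that every `x ∈ {0,1}ⁿ` having an `R`-witness of length `m` has a
seed `uⱼ` and a level `k ≤ m + 2` with exactly one witness hashed to zero,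
`levelCount R m x uⱼ k = 1` ("the bitstrings `w₁, …, w_q` then serve as an advice"). [cite: Burgisser2000TCS, proof of Thm. 3.1 pp. 78–79] [cite: ValiantVazirani1986] [cite: Adleman1978] -/
theorem exists_isolating_seeds (R : Language Bool) (m n t ℓ : ℕ) (ht : 2 ^ n * 7 ^ t < 8 ^ t)
    (hℓ : (m + 2) * (m + 1) ≤ ℓ) :
    ∃ us : Fin t → List.Vector Bool ℓ, ∀ x : List Bool, x.length = n →
      0 < countWitnesses R m x →
        ∃ j, ∃ k ≤ m + 2, Stockmeyer.levelCount R m x (us j).toList k = 1 := by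
  obtain ⟨s, hs⟩ := exists_good_tuple (n := n) (t := t)
    ((univ : Finset (List.Vector Bool n)).filter fun x => 0 < countWitnesses R m x.toList)
    (fun x => univ.filter fun u : List.Vector Bool ℓ =>
      ∃ k ≤ m + 2, Stockmeyer.levelCount R m x.toList u.toList k = 1)
    ((card_filter_le _ _).trans (by rw [card_univ, card_vector, Fintype.card_bool]))
    (fun x hx => Stockmeyer.card_le_eight_mul_card_isolating R x.toList (mem_filter.1 hx).2 hℓ) ht
  refine ⟨s, fun x hxn hx => ?_⟩
  obtain ⟨j, hj⟩ := hs ⟨x, hxn⟩ (mem_filter.2 ⟨mem_univ _, hx⟩)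
  exact ⟨j, by simpa using hj⟩

end Literature.Computability.Complexity
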